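import Literature.Probability.Percolation.NearCriticalScalingLeaves
import Literature.Probability.Percolation.KestenScalingFromSeparation
import Literature.Probability.Percolation.KestenScalingThetaFromTwoFacts
import HarnessLib

/-!
# Nolin's Cor. 41, Cor. 37 and `θ(p) ≍ π₁(L(p))` from near-critical four-arm separation (assembly, proofs only)

Topic `Literature/Probability/Percolation`; family `crit-perc`. PROOFS ONLY (no definition, no
named fact): the state of the discharge of the named fact `Nolin2008_cor41`
(`NearCriticalScaling.lean`; P. Nolin, *Near-critical percolation in two dimensions*, EJP 13
(2008), §7.4, Cor. 41 [arXiv 0711.4948: Cor. 39]: for every fixed `ε ∈ (0, 1/2)`,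
`P_p(0 ⇝ ∞) ≍ P_p(0 ⇝ ∂S_{L_ε(p)})` uniformly for `p > 1/2` near `1/2`), of the equivalence of
lengths Cor. 37 [arXiv Cor. 35] that carries it from small `ε` to every `ε`, and of
`Nolin2008_theta_asymp` (`θ(p) ≍ π₁(L_ε(p))`, eq. (7.25)).

The printed proof of Cor. 41 (arXiv p. 27) glues an arm to `∂S_{L(p)}` to infinity through
overlapping parallelograms crossed "the hard way" with probabilities `1 - C₁ e^{-C₂ 2^k}`
(Lemma 39 / Remark 40 [arXiv Lemma 37 / Remark 38]); Lemma 39 is proved by the block argument for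
`ε` below an RSW threshold `ε₀` and "the result for any `ε ∈ (0, 1/2)` follows readily by using the
equivalence of lengths for different values of `ε`" (Cor. 37), whose own proof (arXiv p. 26) is
Kesten's relation `|p - 1/2| L_ε² π₄(L_ε) ≍ 1` (Prop. 34 [arXiv Prop. 32]) at `ε` and `ε'`,
quasi-multiplicativity of `π₄`, and the a priori bound `π₄(n, N) ≥ C (n/N)^{2-α'}` from five arms.
The tree mirrors this literally and has PROVED every step but one:

* small `ε`, unconditionally: `Nolin2008_cor41_at_holds_small` (`NearCriticalScalingLeaves.lean`);
* every `ε` from Kesten's relation and the two critical four-arm inputs: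
  `Nolin2008_cor41_of_scaling`, through `charLength_lengths_of_prop34` (Cor. 37,
  `CharLengthEquivalence.lean`) and `Nolin2008_cor41_of_lengths`;
* the five-arm lower bound `Werner2009_fourArm_lowerBound_holds` (`FiveArmLowerBound.lean`) and
  the half-plane two-arm bound `Werner2009_halfPlane_twoArm_holds` are theorems;
* Kesten's relation `Nolin2008_prop34_of_separation` (`KestenScalingFromSeparation.lean`), the
  near-critical quasi-multiplicativity `Werner2009_fourArm_quasiMult_of_separation`
  (`NearCriticalFourArmQuasiMult.lean`) and the pivotal lower bound
  `Werner2009_pivotal_lowerBound_of_separation` (`PivotalLowerBoundFromSeparation.lean`) are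
  theorems CONDITIONAL ON ONE INPUT stated as an explicit hypothesis — the comparability,
  uniformly below Werner's length `L(t, ε) = charLengthW ε t`, of the well-separated alternating
  four-arm event `sepFourArm n N` (`ArmSeparationFourArm.lean`) with the four-arm event:
  `c · π̂_t(n, N) ≤ P_t(sepFourArm n N)` for `n₀ ≤ n`, `2n ≤ N`, `N ≤ L(t, ε)` if `t > 1/2`,
  `t ∈ [1/2, 1/2 + δ)` — Nolin's arm-separation Thm. 11 [arXiv Thm. 10] for `j = 4` below `L(p)`,
  after Kesten 1987, Lemmas 4–6.

Hence (this file), from that single separation hypothesis `hsep`: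

* `charLength_le_mul_charLength_of_separation`, `charLength_lengths_of_separation` — **Cor. 37,
  `L_ε(p) ≍ L_{ε'}(p)` for all `ε, ε' ∈ (0, 1/2)`**;
* `Nolin2008_cor41_of_separation` — **Cor. 41 at every `ε ∈ (0, 1/2)`**: the discharge
  `Nolin2008_cor41_holds` is this theorem applied to the near-critical four-arm separation theorem
  once the arm-separation programme (`ArmSeparation*.lean`) reaches `j = 4` below `L(p)`; it is the
  same hypothesis, letter for letter, as in `Nolin2008_prop34_of_separation`,
  `Nolin2008_lemma39_of_separation` (`NearCriticalRadiusDecayFromSeparation.lean`) and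
  `triTheta_exponent_of_separation` (`TriThetaExponentFromSeparation.lean`), so one theorem serves all;
* `Nolin2008_theta_asymp_of_separation` — `θ(p) ≍ π₁(L_ε(p))` for every `ε` (eq. (7.25)).

## References

* P. Nolin, Near-critical percolation in two dimensions, *Electron. J. Probab.* 13 (2008)
  1562–1623, §7.3 Prop. 34 and Cor. 37, §7.4 Lemma 39, Remark 40, Cor. 41 and eq. (7.25); Thm. 11
  (arXiv 0711.4948: Prop. 32, Cor. 35, Lemma 37, Remark 38, Cor. 39; Thm. 10) [Nolin2008].
* H. Kesten, Scaling relations for 2D-percolation, *Comm. Math. Phys.* 109 (1987) 109–156, Thm. 2,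
  (4.5), Lemmas 4–6 [KestenScalingCMP1987].
* W. Werner, *Lectures on two-dimensional critical percolation*, IAS/Park City Math. Ser. 16
  (2009), Lecture 6, Prop. 6.1, Cor. 6.2, Lemma 6.2, §5 [WernerPCMI2009].

Tree: `Nolin2008_cor41_of_scaling` (`NearCriticalScalingLeaves.lean`),
`charLength_le_mul_charLength`, `charLength_lengths_of_prop34` (`CharLengthEquivalence.lean`),
`Nolin2008_theta_asymp_of_facts2` (`KestenScalingThetaFromTwoFacts.lean`),
`Nolin2008_prop34_of_separation` (`KestenScalingFromSeparation.lean`),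
`Werner2009_fourArm_quasiMult_of_separation` (`NearCriticalFourArmQuasiMult.lean`),
`Werner2009_pivotal_lowerBound_of_separation` (`PivotalLowerBoundFromSeparation.lean`),
`Werner2009_fourArm_lowerBound_holds` (`FiveArmLowerBound.lean`).
Mathlib search: nothing percolation-specific in Mathlib; pure assembly.
-/

noncomputable section

namespace Literature.Probability.Percolation

/-! ### Cor. 37: equivalence of lengths from separation -/

/-- **Cor. 37 (`L_ε ≍ L_{ε'}` for all `ε, ε' ∈ (0, 1/2)`) from near-critical four-arm
separation** (Nolin 2008, §7.3, Cor. 37 [arXiv 0711.4948: Cor. 35]; printed proof: Kesten's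
relation at `ε` and `ε'`, quasi-multiplicativity, `π₄(L_{ε'}, L_ε) ≥ C₃ (L_{ε'}/L_ε)^{2-α'}`):
for `0 < ε ≤ ε' < 1/2` there are `δ, K > 0` with `L_ε(p) ≤ K · L_{ε'}(p)` for `p ≠ 1/2`,
`|p - 1/2| < δ` (the other inequality `L_{ε'} ≤ L_ε` is `charLength_anti`) —
`charLength_le_mul_charLength` with `Nolin2008_prop34_of_separation hsep`,
`Werner2009_fourArm_quasiMult_of_separation hsep` and the theorem
`Werner2009_fourArm_lowerBound_holds`. IF `c · π̂_t(n, N) ≤ P_t(sepFourArm n N)` uniformly for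
`n₀ ≤ n`, `2n ≤ N ≤ L(t, ε)`, `t ∈ [1/2, 1/2 + δ)` (Nolin's Thm. 11 [arXiv Thm. 10], `j = 4`, below
`L(p)`), THEN Cor. 37 holds. [cite: Nolin2008, §7.3, Cor. 37 with Prop. 34 and Thm. 11 (arXiv 0711.4948: Cor. 35, Prop. 32, Thm. 10)] [cite: WernerPCMI2009, Lecture 6, Cor. 6.2 and Lemma 6.2] -/
theorem charLength_le_mul_charLength_of_separation
    (hsep : ∃ ε₁ > (0 : ℝ), ∀ ⦃ε : ℝ⦄, 0 < ε → ε < ε₁ →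
      ∃ n₀ : ℕ, ∃ δ > (0 : ℝ), ∃ c > (0 : ℝ),
        ∀ t : unitInterval, 1 / 2 ≤ (t : ℝ) → (t : ℝ) < 1 / 2 + δ →
          ∀ n N : ℕ, n₀ ≤ n → 2 * n ≤ N → (1 / 2 < (t : ℝ) → N ≤ charLengthW ε t) →
            c * fourArmProbAt t n N ≤ (LatticeModels.triSitePercolation t).real (sepFourArm n N))
    {ε ε' : ℝ} (hε : 0 < ε) (hεε' : ε ≤ ε') (hε' : ε' < 1 / 2) :
    ∃ δ > (0 : ℝ), ∃ K > (0 : ℝ), ∀ p : unitInterval, (p : ℝ) ≠ 1 / 2 → |(p : ℝ) - 1 / 2| < δ →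
      (charLength ε p : ℝ) ≤ K * charLength ε' p :=
  charLength_le_mul_charLength (Nolin2008_prop34_of_separation hsep)
    (Werner2009_fourArm_quasiMult_of_separation hsep) Werner2009_fourArm_lowerBound_holds hε hεε' hε'

/-- **Cor. 37 in the one-sided shape consumed by the reductions of Lemma 39 and Cor. 41**
(Nolin 2008, §7.3, Cor. 37 [arXiv 0711.4948: Cor. 35]): from near-critical four-arm separation, for
all `0 < ε₀ < ε < 1/2` there are `δ > 0` and `C` with `L_{ε₀}(p) ≤ C · L_ε(p)` for
`1/2 - δ < p < 1/2` — the hypothesis `hlen` of `Nolin2008_cor41_of_lengths` /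
`Nolin2008_lemma39_of_lengths` (`NearCriticalScalingLeaves.lean`); `charLength_lengths_of_prop34`
with the separation consequences. [cite: Nolin2008, §7.3, Cor. 37 with Prop. 34 and Thm. 11 (arXiv 0711.4948: Cor. 35, Prop. 32, Thm. 10)] -/
theorem charLength_lengths_of_separation
    (hsep : ∃ ε₁ > (0 : ℝ), ∀ ⦃ε : ℝ⦄, 0 < ε → ε < ε₁ →
      ∃ n₀ : ℕ, ∃ δ > (0 : ℝ), ∃ c > (0 : ℝ),
        ∀ t : unitInterval, 1 / 2 ≤ (t : ℝ) → (t : ℝ) < 1 / 2 + δ →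
          ∀ n N : ℕ, n₀ ≤ n → 2 * n ≤ N → (1 / 2 < (t : ℝ) → N ≤ charLengthW ε t) →
            c * fourArmProbAt t n N ≤ (LatticeModels.triSitePercolation t).real (sepFourArm n N)) :
    ∀ ⦃ε₀ ε : ℝ⦄, 0 < ε₀ → ε₀ < ε → ε < 1 / 2 →
      ∃ δ > (0 : ℝ), ∃ C : ℝ, ∀ p : unitInterval, 1 / 2 - δ < (p : ℝ) → (p : ℝ) < 1 / 2 →
        (charLength ε₀ p : ℝ) ≤ C * charLength ε p :=
  charLength_lengths_of_prop34 (Nolin2008_prop34_of_separation hsep)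
    (Werner2009_fourArm_quasiMult_of_separation hsep) Werner2009_fourArm_lowerBound_holds

/-! ### Cor. 41 and eq. (7.25) from separation -/

/-- **Cor. 41 at every `ε ∈ (0, 1/2)` (`Nolin2008_cor41`) from near-critical four-arm
separation** (Nolin 2008, §7.4, Cor. 41 [arXiv 0711.4948: Cor. 39]: "uniformly in `p > 1/2`,
`P_p(0 ⇝ ∞) ≍ P_p(0 ⇝ ∂S_{L(p)})`", `L(p) = L_ε(p)` for any fixed `ε ∈ (0, 1/2)`; printed proof:
"consider overlapping parallelograms, each of size twice larger than the previous one; with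
probability at least `1 - C₁ e^{-C₂ 2^k}` the `k`-th is crossed in the hard way (Remark 40), and
`∏_k (1 - C₁ e^{-C₂ 2^k}) > 0`", the decay of Lemma 39 / Remark 40 holding at every `ε` through
Cor. 37). `Nolin2008_cor41_of_scaling` (ladder, FKG, block argument, its unconditional RSW start
and Cor. 37 — all proved in the tree) with Kesten's relation `Nolin2008_prop34_of_separation hsep`,
the quasi-multiplicativity `Werner2009_fourArm_quasiMult_of_separation hsep` and the theorem
`Werner2009_fourArm_lowerBound_holds`. IF the well-separated alternating four-arm event is
comparable to the four-arm event uniformly below Werner's length — `c · π̂_t(n, N) ≤ P_t(sepFourArm n N)`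
for `n₀ ≤ n`, `2n ≤ N`, `N ≤ L(t, ε)` if `t > 1/2`, `t ∈ [1/2, 1/2 + δ)` (Nolin's Thm. 11
[arXiv Thm. 10] for `j = 4` below `L(p)`; Kesten 1987, Lemmas 4–6) — THEN Cor. 41 holds at every
`ε`. The small-`ε` case is unconditional (`Nolin2008_cor41_at_holds_small`); the discharge
`Nolin2008_cor41_holds` is this theorem applied to that separation theorem once it lands, and no
other input is missing. [cite: Nolin2008, §7.4, Cor. 41 with Lemma 39, Remark 40, §7.3 Prop. 34 and Cor. 37, Thm. 11 (arXiv 0711.4948: Cor. 39, Lemma 37, Remark 38, Prop. 32, Cor. 35, Thm. 10)] [cite: KestenScalingCMP1987, Thm. 2 and Lemmas 4–6] [cite: WernerPCMI2009, Lecture 6, Prop. 6.1, Cor. 6.2, Lemma 6.2] -/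
theorem Nolin2008_cor41_of_separation
    (hsep : ∃ ε₁ > (0 : ℝ), ∀ ⦃ε : ℝ⦄, 0 < ε → ε < ε₁ →
      ∃ n₀ : ℕ, ∃ δ > (0 : ℝ), ∃ c > (0 : ℝ),
        ∀ t : unitInterval, 1 / 2 ≤ (t : ℝ) → (t : ℝ) < 1 / 2 + δ →
          ∀ n N : ℕ, n₀ ≤ n → 2 * n ≤ N → (1 / 2 < (t : ℝ) → N ≤ charLengthW ε t) →
            c * fourArmProbAt t n N ≤ (LatticeModels.triSitePercolation t).real (sepFourArm n N)) :
    Nolin2008_cor41 :=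
  Nolin2008_cor41_of_scaling (Nolin2008_prop34_of_separation hsep)
    (Werner2009_fourArm_quasiMult_of_separation hsep) Werner2009_fourArm_lowerBound_holds

/-- **`θ(p) ≍ π₁(L_ε(p))` for every `ε ∈ (0, 1/2)` (`Nolin2008_theta_asymp`) from near-critical
four-arm separation** (Nolin 2008, §7.4, eq. (7.25) [arXiv 0711.4948: the display following
Cor. 39]: "for `p > 1/2`, `θ(p) ≍ P_p[0 ⇝ ∂S_{L(p)}] ≍ P_{1/2}[0 ⇝ ∂S_{L(p)}]`", Cor. 41 and
Thm. 27 for one arm; Kesten 1987, Thm. 2): `Nolin2008_theta_asymp_of_facts2` with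
`Werner2009_fourArm_quasiMult_of_separation hsep` and
`Werner2009_pivotal_lowerBound_of_separation hsep`. The discharge `Nolin2008_theta_asymp_holds` is
this theorem applied to the near-critical four-arm separation theorem once it lands. [cite: Nolin2008, §7.4, Cor. 41 and eq. (7.25), §6.1 Thm. 27, Thm. 11 (arXiv 0711.4948: Cor. 39 and the display following it, Thm. 26, Thm. 10)] [cite: KestenScalingCMP1987, Thm. 2] [cite: WernerPCMI2009, Lecture 6, §3–§5] -/
theorem Nolin2008_theta_asymp_of_separation
    (hsep : ∃ ε₁ > (0 : ℝ), ∀ ⦃ε : ℝ⦄, 0 < ε → ε < ε₁ →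
      ∃ n₀ : ℕ, ∃ δ > (0 : ℝ), ∃ c > (0 : ℝ),
        ∀ t : unitInterval, 1 / 2 ≤ (t : ℝ) → (t : ℝ) < 1 / 2 + δ →
          ∀ n N : ℕ, n₀ ≤ n → 2 * n ≤ N → (1 / 2 < (t : ℝ) → N ≤ charLengthW ε t) →
            c * fourArmProbAt t n N ≤ (LatticeModels.triSitePercolation t).real (sepFourArm n N)) :
    Nolin2008_theta_asymp :=
  Nolin2008_theta_asymp_of_facts2 (Werner2009_fourArm_quasiMult_of_separation hsep)
    (Werner2009_pivotal_lowerBound_of_separation hsep)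

end Literature.Probability.Percolation
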